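import Mathlib
import HarnessLib
import Summits.KontsevichZagierPeriods.Zeta5Search.Denom.KernelStripStep

/-!
# The squared Barnes kernel on half-integer lines: the profile `π²/cosh²(πy)`

HONEST FRAMING: systematic search; no irrationality claim unless certified.  Pure real/complex analysis;
no arithmetic and no claim about any zeta value is made here.

On a vertical line through a half-integer abscissa `x` (any zero of `cos πx`) the kernel
`(π/sin πt)²`, `t = x + iy`, is the positive real profile `sechSq y = π²/cosh²(πy)`
(`kernel_halfLine`).  We record: its integral `∫_ℝ π²/cosh²(πy) dy = 2π` (`integral_sechSq`, via the
primitive `π tanh πy`) — i.e. `(1/2πi)∫_{½−i∞}^{½+i∞} (π/sin πt)² dt = 1`, the case `ℓ = 0` of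
[Zudilin2014ZetaTwo, Lemma 1] (arXiv:1310.1526) — and the integrability of `sechSq · φ` for continuous
`φ` of polynomial growth (`integrable_sechSq_mul`, using `KernelStripStep.pow_le_sinh_sq`).  These are the
model integrals of the residue version of the unit strip step (`KernelResidueStep`).
-/

noncomputable section

open Complex Set MeasureTheory Filter Topology
open Summit.KontsevichZagierPeriods.Zeta5Search.Denom.KernelStripStep

namespace Summit.KontsevichZagierPeriods.Zeta5Search.Denom.KernelSechSq

/-! ### The kernel on half-integer lines: the real profile `π² / cosh²(πy)` -/

/-- The profile `π² / cosh²(πy)`. -/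
def sechSq (y : ℝ) : ℝ := Real.pi ^ 2 / Real.cosh (Real.pi * y) ^ 2

/-- `sechSq` is nonnegative. -/
theorem sechSq_nonneg (y : ℝ) : 0 ≤ sechSq y := by
  unfold sechSq
  positivity

/-- `sechSq ≤ π²`. -/
theorem sechSq_le_pi_sq (y : ℝ) : sechSq y ≤ Real.pi ^ 2 := by
  unfold sechSq
  have h1 : 1 ≤ Real.cosh (Real.pi * y) ^ 2 := by nlinarith [Real.one_le_cosh (Real.pi * y)]
  exact div_le_self (by positivity) h1

-- lane edit (lead/lit g13, dedup.landed): the stand-alone lemma `self_sq_le_sinh_sq` (x² ≤ sinh² x) restated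
-- `Literature.Barriers.CriticalPhenomena.NewmanLeeYang.sq_le_sinh_sq`; it is inlined at its single use site below.

/-- `1 + y² ≤ cosh²(πy)`. -/
theorem one_add_sq_le_cosh_sq (y : ℝ) : 1 + y ^ 2 ≤ Real.cosh (Real.pi * y) ^ 2 := by
  rw [Real.cosh_sq]
  have h1 : (Real.pi * y) ^ 2 ≤ Real.sinh (Real.pi * y) ^ 2 := by
    have h : |Real.pi * y| ≤ |Real.sinh (Real.pi * y)| := by
      rw [Real.abs_sinh]; exact Real.self_le_sinh_iff.2 (abs_nonneg _)
    calc (Real.pi * y) ^ 2 = |Real.pi * y| ^ 2 := (sq_abs _).symm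
      _ ≤ |Real.sinh (Real.pi * y)| ^ 2 := pow_le_pow_left₀ (abs_nonneg _) h 2
      _ = Real.sinh (Real.pi * y) ^ 2 := sq_abs _
  have hπ : 1 ≤ Real.pi := by linarith [Real.pi_gt_three]
  have h2 : y ^ 2 ≤ (Real.pi * y) ^ 2 := by
    rw [mul_pow]
    nlinarith [sq_nonneg y, one_le_pow₀ (M₀ := ℝ) hπ (n := 2)]
  linarith

/-- `sechSq y ≤ π² / (1 + y²)`. -/
theorem sechSq_le_div (y : ℝ) : sechSq y ≤ Real.pi ^ 2 / (1 + y ^ 2) :=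
  div_le_div_of_nonneg_left (by positivity) (by positivity) (one_add_sq_le_cosh_sq y)

/-- `sechSq` is continuous. -/
theorem continuous_sechSq : Continuous sechSq := by
  unfold sechSq
  exact continuous_const.div (by fun_prop) fun y => by positivity

/-- `sechSq` is integrable. -/
theorem integrable_sechSq : Integrable sechSq := by
  refine (integrable_inv_one_add_sq.const_mul (Real.pi ^ 2)).mono' continuous_sechSq.aestronglyMeasurable
    (Eventually.of_forall fun y => ?_)
  rw [Real.norm_eq_abs, abs_of_nonneg (sechSq_nonneg y), ← div_eq_mul_inv]
  exact sechSq_le_div y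

/-- `cos (π(m + ½)) = 0`. -/
theorem cos_pi_mul_intCast_add_half (m : ℤ) : Real.cos (Real.pi * ((m : ℝ) + 1 / 2)) = 0 :=
  Real.cos_eq_zero_iff.2 ⟨m, by ring⟩

/-- `cos (π(m − ½)) = 0`. -/
theorem cos_pi_mul_intCast_sub_half (m : ℤ) : Real.cos (Real.pi * ((m : ℝ) - 1 / 2)) = 0 :=
  Real.cos_eq_zero_iff.2 ⟨m - 1, by push_cast; ring⟩

/-- **The kernel on a line through a zero of `cos πx`** (i.e. a half-integer abscissa):
`(π / sin π(x + iy))² = π² / cosh²(πy)`, a positive real. -/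
theorem kernel_halfLine {x : ℝ} (hx : Real.cos (Real.pi * x) = 0) (y : ℝ) :
    ((Real.pi : ℂ) / Complex.sin (Real.pi * ((x : ℂ) + (y : ℂ) * I))) ^ 2 = ((sechSq y : ℝ) : ℂ) := by
  have hsin2 : Real.sin (Real.pi * x) ^ 2 = 1 := by
    have := Real.sin_sq_add_cos_sq (Real.pi * x)
    rw [hx] at this
    linarith
  have hs : Complex.sin (Real.pi * ((x : ℂ) + (y : ℂ) * I)) =
      (Real.sin (Real.pi * x) : ℂ) * (Real.cosh (Real.pi * y) : ℂ) := by
    have harg : (Real.pi : ℂ) * ((x : ℂ) + (y : ℂ) * I) =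
        ((Real.pi * x : ℝ) : ℂ) + ((Real.pi * y : ℝ) : ℂ) * I := by
      push_cast
      ring
    rw [harg, Complex.sin_add, Complex.sin_mul_I, Complex.cos_mul_I, ← Complex.ofReal_sin,
      ← Complex.ofReal_cos, hx, Complex.ofReal_cosh]
    push_cast
    ring
  have hsin2' : ((Real.sin (Real.pi * x) : ℂ)) ^ 2 = 1 := by exact_mod_cast hsin2
  rw [hs, div_pow, mul_pow, hsin2', one_mul, sechSq]
  push_cast
  ring

/-! ### `∫ π²/cosh²(πy) dy = 2π` -/

/-- The primitive `π · tanh(πy)`, written with `sinh / cosh`. -/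
def piTanh (y : ℝ) : ℝ := Real.pi * (Real.sinh (Real.pi * y) / Real.cosh (Real.pi * y))

/-- `(π tanh πy)′ = π² / cosh²(πy)`. -/
theorem hasDerivAt_piTanh (y : ℝ) : HasDerivAt piTanh (sechSq y) y := by
  have hc : Real.cosh (Real.pi * y) ≠ 0 := (Real.cosh_pos _).ne'
  have hl : HasDerivAt (fun y : ℝ => Real.pi * y) Real.pi y := by
    simpa using (hasDerivAt_id y).const_mul Real.pi
  have hs : HasDerivAt (fun y => Real.sinh (Real.pi * y)) (Real.cosh (Real.pi * y) * Real.pi) y :=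
    (Real.hasDerivAt_sinh _).comp y hl
  have hco : HasDerivAt (fun y => Real.cosh (Real.pi * y)) (Real.sinh (Real.pi * y) * Real.pi) y :=
    (Real.hasDerivAt_cosh _).comp y hl
  have h := (hs.div hco hc).const_mul Real.pi
  have h3 : Real.cosh (Real.pi * y) * Real.pi * Real.cosh (Real.pi * y) -
      Real.sinh (Real.pi * y) * (Real.sinh (Real.pi * y) * Real.pi) = Real.pi := by
    have h2 := Real.cosh_sq (Real.pi * y)
    linear_combination Real.pi * h2
  have h4 : Real.pi * ((Real.cosh (Real.pi * y) * Real.pi * Real.cosh (Real.pi * y) -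
      Real.sinh (Real.pi * y) * (Real.sinh (Real.pi * y) * Real.pi)) / Real.cosh (Real.pi * y) ^ 2) =
      sechSq y := by
    rw [h3, sechSq]
    ring
  exact h.congr_deriv h4

/-- `sinh x / cosh x = 1 − 2/(e^{2x} + 1)`. -/
theorem sinh_div_cosh_eq (x : ℝ) : Real.sinh x / Real.cosh x = 1 - 2 / (Real.exp (2 * x) + 1) := by
  rw [Real.sinh_eq, Real.cosh_eq, Real.exp_neg, show (2 : ℝ) * x = x + x by ring, Real.exp_add]
  have he : 0 < Real.exp x := Real.exp_pos x
  field_simp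
  ring

/-- `π tanh πy → π` as `y → +∞`. -/
theorem tendsto_piTanh_atTop : Tendsto piTanh atTop (𝓝 Real.pi) := by
  have h1 : Tendsto (fun y : ℝ => Real.exp (2 * (Real.pi * y)) + 1) atTop atTop := by
    refine tendsto_atTop_add_const_right _ 1 (Real.tendsto_exp_atTop.comp ?_)
    exact (tendsto_id.const_mul_atTop Real.pi_pos).const_mul_atTop two_pos
  have h2 : Tendsto (fun y : ℝ => (2 : ℝ) / (Real.exp (2 * (Real.pi * y)) + 1)) atTop (𝓝 0) :=
    tendsto_const_nhds.div_atTop h1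
  have h3 : Tendsto (fun y : ℝ => Real.pi * (1 - 2 / (Real.exp (2 * (Real.pi * y)) + 1))) atTop
      (𝓝 (Real.pi * (1 - 0))) := (tendsto_const_nhds.sub h2).const_mul Real.pi
  rw [sub_zero, mul_one] at h3
  refine h3.congr fun y => ?_
  rw [piTanh, sinh_div_cosh_eq]

/-- `π tanh πy → −π` as `y → −∞`. -/
theorem tendsto_piTanh_atBot : Tendsto piTanh atBot (𝓝 (-Real.pi)) := by
  have h := (tendsto_piTanh_atTop.comp tendsto_neg_atBot_atTop).neg
  refine h.congr fun y => ?_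
  simp [piTanh, Real.sinh_neg, Real.cosh_neg, neg_div]

/-- **`∫_ℝ π²/cosh²(πy) dy = 2π`** — equivalently `(1/2πi) ∫_{½−i∞}^{½+i∞} (π/sin πt)² dt = 1`. -/
theorem integral_sechSq : ∫ y : ℝ, sechSq y = 2 * Real.pi := by
  rw [integral_of_hasDerivAt_of_tendsto hasDerivAt_piTanh integrable_sechSq tendsto_piTanh_atBot
    tendsto_piTanh_atTop]
  ring

/-! ### Integrability on a line from polynomial growth -/

/-- `sechSq · φ` is integrable when `φ` is continuous of polynomial growth. -/
theorem integrable_sechSq_mul {φ : ℝ → ℂ} (hφ : Continuous φ) {A : ℝ} {N : ℕ}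
    (hA : ∀ y : ℝ, ‖φ y‖ ≤ A * (1 + y ^ 2) ^ N) :
    Integrable fun y : ℝ => ((sechSq y : ℝ) : ℂ) * φ y := by
  set cN : ℝ := (2 : ℝ) ^ (N + 1) / Real.pi ^ (2 * N + 2) * (Nat.factorial (2 * N + 2)) * 4 with hcN
  have hA0 : 0 ≤ A := by
    have h := hA 0
    simp only [ne_eq, OfNat.ofNat_ne_zero, not_false_eq_true, zero_pow, add_zero, one_pow, mul_one] at h
    exact (norm_nonneg _).trans h
  have hcN0 : 0 ≤ cN := by positivity
  set C : ℝ := Real.pi ^ 2 * A * (cN + 2 ^ (N + 1)) with hC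
  refine (integrable_inv_one_add_sq.const_mul C).mono'
    ((Complex.continuous_ofReal.comp continuous_sechSq).mul hφ).aestronglyMeasurable
    (Eventually.of_forall fun y => ?_)
  rw [norm_mul, Complex.norm_real, Real.norm_eq_abs, abs_of_nonneg (sechSq_nonneg y)]
  have hq : (1 : ℝ) ≤ 1 + y ^ 2 := by nlinarith [sq_nonneg y]
  rcases le_or_gt 1 |y| with hy | hy
  · -- the tail `|y| ≥ 1`
    have hs := pow_le_sinh_sq N hy
    rw [← hcN] at hs
    have hy0 : y ≠ 0 := by
      intro h
      rw [h, abs_zero] at hy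
      linarith
    have hsinh_pos : 0 < Real.sinh (Real.pi * y) ^ 2 := by
      have : Real.sinh (Real.pi * y) ≠ 0 := by
        rw [Real.sinh_eq_zero.ne]
        exact mul_ne_zero Real.pi_ne_zero hy0
      positivity
    have hsc : sechSq y ≤ Real.pi ^ 2 / Real.sinh (Real.pi * y) ^ 2 := by
      unfold sechSq
      refine div_le_div_of_nonneg_left (by positivity) hsinh_pos ?_
      rw [Real.cosh_sq]
      linarith
    have hinv : 1 / Real.sinh (Real.pi * y) ^ 2 ≤ cN / (1 + y ^ 2) ^ (N + 1) := by
      rw [div_le_div_iff₀ hsinh_pos (by positivity)]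
      linarith
    calc sechSq y * ‖φ y‖
        ≤ Real.pi ^ 2 / Real.sinh (Real.pi * y) ^ 2 * (A * (1 + y ^ 2) ^ N) :=
          mul_le_mul hsc (hA y) (norm_nonneg _) (by positivity)
      _ = Real.pi ^ 2 * A * (1 + y ^ 2) ^ N * (1 / Real.sinh (Real.pi * y) ^ 2) := by ring
      _ ≤ Real.pi ^ 2 * A * (1 + y ^ 2) ^ N * (cN / (1 + y ^ 2) ^ (N + 1)) := by gcongr
      _ = Real.pi ^ 2 * A * cN * (1 + y ^ 2)⁻¹ := by
          rw [pow_succ]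
          field_simp
          ring
      _ ≤ C * (1 + y ^ 2)⁻¹ := by
          rw [hC]
          gcongr
          linarith [pow_pos (two_pos (α := ℝ)) (N + 1)]
  · -- the core `|y| < 1`
    have hy2 : y ^ 2 ≤ 1 := by nlinarith [abs_nonneg y, sq_abs y]
    have hq2 : 1 + y ^ 2 ≤ 2 := by linarith
    calc sechSq y * ‖φ y‖ ≤ Real.pi ^ 2 * (A * (1 + y ^ 2) ^ N) :=
          mul_le_mul (sechSq_le_pi_sq y) (hA y) (norm_nonneg _) (by positivity)
      _ ≤ Real.pi ^ 2 * (A * 2 ^ N) := by gcongr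
      _ = Real.pi ^ 2 * A * 2 ^ (N + 1) * (2 : ℝ)⁻¹ := by rw [pow_succ]; ring
      _ ≤ Real.pi ^ 2 * A * 2 ^ (N + 1) * (1 + y ^ 2)⁻¹ := by
          gcongr
      _ ≤ C * (1 + y ^ 2)⁻¹ := by
          rw [hC]
          gcongr
          linarith

end Summit.KontsevichZagierPeriods.Zeta5Search.Denom.KernelSechSq

end
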